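import Mathlib
import Literature.NumberTheory.Sieve.LinearEquationsInPrimes
import Summits.Parity.GeneralizedHardyLittlewood.Theorems.LiouvilleShiftedTablesPairsToGHLStubRungMainAux1

/-!
# Sloped ladder: `stub_rungMainPart` — the main term of the rung

Route `LiouvilleShiftedTables` (Parity / GeneralizedHardyLittlewood), crux stmt-Parity-9389
(`Summit.Parity.GeneralizedHardyLittlewood.Theses.LiouvilleShiftedTables.PairsToGHL`), line
`sloped_ladder`, registered stub `stub_rungMainPart`.

In the rung of Bombieri's asymptotic sieve for the adjoined form `ψ(n) = α n + β` against the
tuple weight `F(n) = ∏ᵢ Λ(Φᵢ(n))`, after replacing `𝟙[d ∣ m(n)]` (`m(n) = ψ(n)`) by the density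
`w̃(d)` on the divisors `d ≤ X(n) = m(n)/(⌊N^{ε₁}⌋+1)`, the main term is

  `M(N) = ∑_{n ≤ N} F(n) ∑_{d ≤ X(n)} μ(d) w̃(d) log(m(n)/d)`.

We show `M(N) = 𝔖(vecCons ψ Φ) N + o(N)` from the inductive hypothesis
`S(N) = ∑_{n ≤ N} F(n) = 𝔖(Φ) N + o(N)` and the three Euler estimates of `stub_slopedEuler` for
`A₀(x) = ∑_{d ≤ x} μ w̃`, `A₁(x) = ∑_{d ≤ x} μ w̃ log`:
`|A₀(x)| ≤ C/log² x`, `|A₁(x)| ≤ C`, `|𝔖(Φ) A₁(x) + 𝔖(vecCons ψ Φ)| ≤ C/log x` (`x ≥ 2`).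

The abstract estimate is `RungMain.main_abstract` (for any `F ≥ 0` with `S(N) = 𝔖 N + o(N)`,
`n ≤ m(n) ≤ K n`, `W 1 = 1`): split at `n ≤ √N` (trivial bounds of part 1, `S(√N) ≤ (|𝔖|+1)√N`,
total `O(√N log N)`) and `n > √N`, where `X(n) ≥ N^{1/4}` (part 1, `two_le_div_and_log_le`):
with `ρ = 𝔖'/𝔖` (`ρ = 0` and `𝔖' = 0` when `𝔖 = 0`, by the third estimate) the inner sum is
`ρ + O(1/log N)` against `S(N) = O(N)` if `𝔖 ≠ 0`, and `O(1)` against `S(N) = o(N)` if `𝔖 = 0`;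
finally `ρ (S(N) - 𝔖 N) = o(N)`. The registered statement follows with `F(n) = ∏ᵢ Λ(Φᵢ(n))`,
`m(n) = ψ(n)`, `K = α + β`, `w̃(1) = 1`.

[folklore]
-/

noncomputable section

open Finset Real Filter
open scoped ArithmeticFunction.Moebius Topology

namespace Summit.Parity.GeneralizedHardyLittlewood.Theorems.PairsToGHL.SlopedLadder

namespace RungMain

variable {W : ℕ → ℝ} {C 𝔖 𝔖' : ℝ}

/-- The algebraic split of `∑ F I - 𝔖' X` into the small range, the big range measured against
`ρ`, and `ρ (∑ F - 𝔖 X)`, with the triangle inequality. [folklore] -/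
theorem core_split (s : Finset ℕ) (p : ℕ → Prop) [DecidablePred p] {F I : ℕ → ℝ}
    (hF : ∀ n, 0 ≤ F n) {ρ 𝔖 𝔖' X : ℝ} (h𝔖 : 𝔖' = ρ * 𝔖) :
    |∑ n ∈ s, F n * I n - 𝔖' * X| ≤
      ∑ n ∈ s.filter p, F n * |I n| + ∑ n ∈ s.filter (fun n => ¬ p n), F n * |I n - ρ| +
        |ρ| * (|∑ n ∈ s, F n - 𝔖 * X| + ∑ n ∈ s.filter p, F n) := by
  have e1 := Finset.sum_filter_add_sum_filter_not s p (fun n => F n * I n)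
  have e2 := Finset.sum_filter_add_sum_filter_not s p F
  have e3 : ∑ n ∈ s.filter (fun n => ¬ p n), F n * (I n - ρ) =
      ∑ n ∈ s.filter (fun n => ¬ p n), F n * I n - ρ * ∑ n ∈ s.filter (fun n => ¬ p n), F n := by
    rw [Finset.mul_sum, ← Finset.sum_sub_distrib]
    exact Finset.sum_congr rfl fun n _ => by ring
  have key : ∑ n ∈ s, F n * I n - 𝔖' * X =
      ∑ n ∈ s.filter p, F n * I n + ∑ n ∈ s.filter (fun n => ¬ p n), F n * (I n - ρ) +
        ρ * ((∑ n ∈ s, F n - 𝔖 * X) - ∑ n ∈ s.filter p, F n) := by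
    rw [h𝔖]; linear_combination -e1 + ρ * e2 - e3
  rw [key]
  refine (abs_add_three _ _ _).trans (add_le_add_three ?_ ?_ ?_)
  · refine (Finset.abs_sum_le_sum_abs _ _).trans (le_of_eq (Finset.sum_congr rfl fun n _ => ?_))
    rw [abs_mul, abs_of_nonneg (hF n)]
  · refine (Finset.abs_sum_le_sum_abs _ _).trans (le_of_eq (Finset.sum_congr rfl fun n _ => ?_))
    rw [abs_mul, abs_of_nonneg (hF n)]
  · rw [abs_mul]
    refine mul_le_mul_of_nonneg_left ((abs_sub _ _).trans (le_of_eq ?_)) (abs_nonneg _)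
    rw [abs_of_nonneg (Finset.sum_nonneg fun n _ => hF n)]

/-- The big range `n > √N`: `|inner - ρ| ≤ β(N)` with `ρ = 𝔖'/𝔖`, `β = (32|𝔖|C + 4C)/(|𝔖| log N)`
if `𝔖 ≠ 0`, and `ρ = 0`, `β = 32C/log N + C` if `𝔖 = 0`. [folklore] -/
theorem abs_mainInner_sub_le_big
    (hE0 : ∀ x : ℕ, 2 ≤ x → |(∑ d ∈ Icc 1 x, (μ d : ℝ) * W d)| ≤ C / Real.log x ^ 2)
    (hE1 : ∀ x : ℕ, 2 ≤ x → |(∑ d ∈ Icc 1 x, (μ d : ℝ) * W d * Real.log d)| ≤ C)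
    (hE2 : ∀ x : ℕ, 2 ≤ x →
      |𝔖 * (∑ d ∈ Icc 1 x, (μ d : ℝ) * W d * Real.log d) + 𝔖'| ≤ C / Real.log x)
    {ε₁ : ℝ} (hε : ε₁ ≤ 1 / 8) {N n m K : ℕ} (hN : 256 ≤ N) (hKN : K ≤ N)
    (hn : Nat.sqrt N < n) (hnN : n ≤ N) (hm₁ : n ≤ m) (hm₂ : m ≤ K * n) :
    |(∑ d ∈ Icc 1 (m / (⌊(N : ℝ) ^ ε₁⌋₊ + 1)), (μ d : ℝ) * W d * Real.log ((m : ℝ) / d)) -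
        (if 𝔖 = 0 then 0 else 𝔖' / 𝔖)| ≤
      (if 𝔖 = 0 then 32 * C / Real.log N + C
        else (32 * |𝔖| * C + 4 * C) / (|𝔖| * Real.log N)) := by
  obtain ⟨hX2, hlogX⟩ := two_le_div_and_log_le hε hN hn hm₁
  have hn1 : 1 ≤ n := by omega
  have hm1 : 1 ≤ m := hn1.trans hm₁
  have hL : 0 < Real.log N := Real.log_pos (by exact_mod_cast (show 1 < N by omega))
  have hlogm : Real.log m ≤ 2 * Real.log N := by
    have h1 : (m : ℝ) ≤ (N : ℝ) ^ 2 := by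
      rw [sq]; exact_mod_cast hm₂.trans (Nat.mul_le_mul hKN hnN)
    have h2 := Real.log_le_log (by exact_mod_cast (show 0 < m by omega)) h1
    rwa [Real.log_pow, Nat.cast_ofNat] at h2
  by_cases h𝔖 : 𝔖 = 0
  · simp only [h𝔖, if_true, sub_zero]
    exact abs_mainInner_le_good hE0 hE1 hX2 hL hlogX hm1 hlogm
  · simp only [h𝔖, if_false]
    have key := abs_mul_mainInner_sub_le_good hE0 hE1 hE2 hX2 hL hlogX hm1 hlogm
    have h𝔖pos : 0 < |𝔖| := abs_pos.2 h𝔖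
    set I := (∑ d ∈ Icc 1 (m / (⌊(N : ℝ) ^ ε₁⌋₊ + 1)), (μ d : ℝ) * W d * Real.log ((m : ℝ) / d))
    rw [show I - 𝔖' / 𝔖 = (𝔖 * I - 𝔖') / 𝔖 by field_simp, abs_div, div_le_iff₀ h𝔖pos]
    calc |𝔖 * I - 𝔖'| ≤ (32 * |𝔖| * C + 4 * C) / Real.log N := key
      _ = (32 * |𝔖| * C + 4 * C) / (|𝔖| * Real.log N) * |𝔖| := by field_simp

/-- Eventually `S(N) β(N) ≤ (η/4) N`: for `𝔖 = 0` because `S(N) = o(N)` and `β = O(1)`, for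
`𝔖 ≠ 0` because `S(N) = O(N)` and `β = O(1/log N)`. [folklore] -/
theorem eventually_mul_beta_le {S : ℕ → ℝ}
    (hS : (fun N : ℕ => S N - 𝔖 * N) =o[atTop] fun N : ℕ => (N : ℝ)) (hC : 0 ≤ C) {η : ℝ}
    (hη : 0 < η) :
    ∀ᶠ N : ℕ in atTop, S N * (if 𝔖 = 0 then 32 * C / Real.log N + C
        else (32 * |𝔖| * C + 4 * C) / (|𝔖| * Real.log N)) ≤ η / 4 * N := by
  have hlog : Tendsto (fun N : ℕ => Real.log N) atTop atTop :=
    Real.tendsto_log_atTop.comp tendsto_natCast_atTop_atTop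
  by_cases h𝔖 : 𝔖 = 0
  · simp only [h𝔖, if_true]
    set κ₀ : ℝ := η / (4 * (33 * C + 1)) with hκ₀
    have hκ₀0 : 0 < κ₀ := by positivity
    filter_upwards [eventually_abs_sub_le hS hκ₀0, hlog.eventually_ge_atTop 1] with N h1 h2
    have hSN : S N ≤ κ₀ * N := by
      rw [h𝔖, zero_mul, sub_zero] at h1
      exact (le_abs_self _).trans h1
    have hβ : 32 * C / Real.log N + C ≤ 33 * C := by
      have : 32 * C / Real.log N ≤ 32 * C := div_le_self (by positivity) h2
      linarith
    have hβ0 : 0 ≤ 32 * C / Real.log N + C := by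
      have : 0 ≤ Real.log N := by linarith
      positivity
    calc S N * (32 * C / Real.log N + C) ≤ κ₀ * N * (33 * C) :=
          mul_le_mul hSN hβ hβ0 (by positivity)
      _ = η / 4 * N * (33 * C / (33 * C + 1)) := by
          rw [hκ₀]; field_simp
      _ ≤ η / 4 * N * 1 :=
          mul_le_mul_of_nonneg_left (div_le_one_of_le₀ (by linarith) (by positivity))
            (by positivity)
      _ = η / 4 * N := mul_one _
  · simp only [h𝔖, if_false]
    have h𝔖pos : 0 < |𝔖| := abs_pos.2 h𝔖
    set D : ℝ := (|𝔖| + 1) * (32 * |𝔖| * C + 4 * C) / |𝔖| with hD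
    have hD0 : 0 ≤ D := by positivity
    filter_upwards [eventually_le_mul hS, hlog.eventually_ge_atTop (4 * D / η + 1)] with N h1 h2
    have h4D : 0 ≤ 4 * D / η := by positivity
    have hL : 0 < Real.log N := by linarith
    have hDL : D / Real.log N ≤ η / 4 := by
      rw [div_le_iff₀ hL]
      have : η / 4 * (4 * D / η) = D := by field_simp
      nlinarith
    calc S N * ((32 * |𝔖| * C + 4 * C) / (|𝔖| * Real.log N))
        ≤ (|𝔖| + 1) * N * ((32 * |𝔖| * C + 4 * C) / (|𝔖| * Real.log N)) :=
          mul_le_mul_of_nonneg_right h1 (by positivity)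
      _ = D / Real.log N * N := by rw [hD]; field_simp
      _ ≤ η / 4 * N := mul_le_mul_of_nonneg_right hDL (Nat.cast_nonneg _)

/-- **The main term of the rung, abstract form.** For `F ≥ 0` with `∑_{n ≤ N} F = 𝔖 N + o(N)`,
`n ≤ m(n) ≤ K n`, `W 1 = 1` and the three Euler estimates, for every `ε₁ ≤ 1/8` and `η > 0`:
`|∑_{n ≤ N} F(n) ∑_{d ≤ m(n)/(⌊N^{ε₁}⌋+1)} μ(d) W(d) log(m(n)/d) - 𝔖' N| ≤ η N` for all large `N`.
[folklore] -/
theorem main_abstract {F : ℕ → ℝ} {W : ℕ → ℝ} {m : ℕ → ℕ} {K : ℕ} {𝔖 𝔖' C ε₁ η : ℝ}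
    (hF : ∀ n, 0 ≤ F n) (hm₁ : ∀ n, n ≤ m n) (hm₂ : ∀ n, 1 ≤ n → m n ≤ K * n)
    (hW1 : W 1 = 1)
    (hS : (fun N : ℕ => ∑ n ∈ Icc 1 N, F n - 𝔖 * N) =o[atTop] fun N : ℕ => (N : ℝ))
    (hE : ∀ x : ℕ, 2 ≤ x →
      |(∑ d ∈ Icc 1 x, (μ d : ℝ) * W d)| ≤ C / Real.log x ^ 2 ∧
        |(∑ d ∈ Icc 1 x, (μ d : ℝ) * W d * Real.log d)| ≤ C ∧
          |𝔖 * (∑ d ∈ Icc 1 x, (μ d : ℝ) * W d * Real.log d) + 𝔖'| ≤ C / Real.log x)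
    (hε : ε₁ ≤ 1 / 8) (hη : 0 < η) :
    ∃ N₀ : ℕ, ∀ N : ℕ, N₀ ≤ N →
      |∑ n ∈ Icc 1 N, F n * (∑ d ∈ Icc 1 (m n / (⌊(N : ℝ) ^ ε₁⌋₊ + 1)),
          (μ d : ℝ) * W d * Real.log ((m n : ℝ) / d)) - 𝔖' * N| ≤ η * N := by
  have hE0 := fun x hx => (hE x hx).1
  have hE1 := fun x hx => (hE x hx).2.1
  have hE2 := fun x hx => (hE x hx).2.2
  have hC : 0 ≤ C := nonneg_of_euler hE1
  have hK : 1 ≤ K := by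
    have := (hm₁ 1).trans (hm₂ 1 le_rfl); omega
  -- `ρ = 𝔖'/𝔖` (or `0`), `𝔖' = ρ 𝔖`
  set ρ : ℝ := if 𝔖 = 0 then 0 else 𝔖' / 𝔖 with hρ
  have h𝔖' : 𝔖' = ρ * 𝔖 := by
    by_cases h : 𝔖 = 0
    · have h' : 𝔖' = 0 :=
        eq_zero_of_abs_le_div_log (C := C) fun x hx => by simpa [h] using hE2 x hx
      simp [hρ, h, h']
    · simp [hρ, h]
  -- notation and the eventual facts
  set S : ℕ → ℝ := fun N => ∑ n ∈ Icc 1 N, F n with hSdef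
  set B₀ : ℝ := C / Real.log 2 ^ 2 + 1 with hB₀
  have hB₀0 : 0 ≤ B₀ := by have := Real.log_pos one_lt_two; positivity
  set κ : ℝ := η / (4 * (|ρ| + 1)) with hκ
  have hκ0 : 0 < κ := by positivity
  have hκ' : |ρ| * κ ≤ η / 4 := by
    rw [hκ, mul_div_assoc', div_le_div_iff₀ (by positivity) (by positivity)]
    nlinarith [abs_nonneg ρ]
  have ev1 : ∀ᶠ N : ℕ in atTop, |S N - 𝔖 * N| ≤ κ * N := eventually_abs_sub_le hS hκ0
  have ev2 : ∀ᶠ N : ℕ in atTop, S (Nat.sqrt N) ≤ (|𝔖| + 1) * Real.sqrt N :=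
    eventually_sqrt_le hS
  have ev3 : ∀ᶠ N : ℕ in atTop, Real.sqrt N * ((|𝔖| + 1) * B₀ * Real.log N +
      (|𝔖| + 1) * (Real.log K * B₀ + C + |ρ|)) ≤ η / 4 * N :=
    eventually_sqrt_mul_le (by positivity) (by positivity) (by positivity)
  have ev4 := eventually_mul_beta_le hS hC hη
  obtain ⟨N₀, hN₀⟩ := Filter.eventually_atTop.1
    (ev1.and (ev2.and (ev3.and (ev4.and (eventually_ge_atTop (max 256 K))))))
  refine ⟨N₀, fun N hN => ?_⟩
  obtain ⟨h1, h2, h3, h4, h5⟩ := hN₀ N hN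
  have hN256 : 256 ≤ N := le_of_max_le_left h5
  have hKN : K ≤ N := le_of_max_le_right h5
  have hN0 : (0 : ℝ) < N := by exact_mod_cast (show 0 < N by omega)
  have hlogN : 0 ≤ Real.log N := Real.log_nonneg (by exact_mod_cast (show 1 ≤ N by omega))
  -- the split at `T = ⌊√N⌋`
  set T : ℕ := Nat.sqrt N with hT
  set M₀ : ℕ := ⌊(N : ℝ) ^ ε₁⌋₊ with hM₀
  set I : ℕ → ℝ := fun n =>
    (∑ d ∈ Icc 1 (m n / (M₀ + 1)), (μ d : ℝ) * W d * Real.log ((m n : ℝ) / d)) with hI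
  set Triv : ℝ := (Real.log K + Real.log N) * B₀ + C with hTriv
  have hTriv0 : 0 ≤ Triv := by
    have := Real.log_nonneg (show (1 : ℝ) ≤ K by exact_mod_cast hK); positivity
  refine (core_split (Icc 1 N) (fun n => n ≤ T) hF h𝔖' (I := I) (X := (N : ℝ))).trans ?_
  -- the small part of `S`
  set Ssmall : ℝ := ∑ n ∈ (Icc 1 N).filter (fun n => n ≤ T), F n with hSsmall_def
  have hSsmall_le : Ssmall ≤ (|𝔖| + 1) * Real.sqrt N := by
    refine le_trans ?_ h2
    refine Finset.sum_le_sum_of_subset_of_nonneg (fun n hn => ?_) (fun n _ _ => hF n)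
    simp only [Finset.mem_filter, Finset.mem_Icc] at hn ⊢
    omega
  have hSsmall0 : 0 ≤ Ssmall := Finset.sum_nonneg fun n _ => hF n
  -- term 1: small `n`
  have hsmall : ∑ n ∈ (Icc 1 N).filter (fun n => n ≤ T), F n * |I n| ≤ Triv * Ssmall := by
    rw [hSsmall_def, Finset.mul_sum]
    refine Finset.sum_le_sum fun n hn => ?_
    simp only [Finset.mem_filter, Finset.mem_Icc] at hn
    rw [mul_comm Triv]
    refine mul_le_mul_of_nonneg_left ?_ (hF n)
    have hmn : 1 ≤ m n := hn.1.1.trans (hm₁ n)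
    refine (abs_mainInner_le_triv hW1 hE0 hE1 hmn _).trans ?_
    have hlogm : Real.log (m n) ≤ Real.log K + Real.log N := by
      rw [← Real.log_mul (by exact_mod_cast (show K ≠ 0 by omega)) hN0.ne']
      refine Real.log_le_log (by exact_mod_cast (show 0 < m n by omega)) ?_
      exact_mod_cast (hm₂ n hn.1.1).trans (Nat.mul_le_mul_left K hn.1.2)
    nlinarith
  -- term 2: big `n`
  have hbig : ∑ n ∈ (Icc 1 N).filter (fun n => ¬ n ≤ T), F n * |I n - ρ| ≤ η / 4 * N := by
    refine le_trans ?_ h4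
    calc ∑ n ∈ (Icc 1 N).filter (fun n => ¬ n ≤ T), F n * |I n - ρ|
        ≤ ∑ n ∈ (Icc 1 N).filter (fun n => ¬ n ≤ T), F n *
            (if 𝔖 = 0 then 32 * C / Real.log N + C
              else (32 * |𝔖| * C + 4 * C) / (|𝔖| * Real.log N)) := by
          refine Finset.sum_le_sum fun n hn => mul_le_mul_of_nonneg_left ?_ (hF n)
          simp only [Finset.mem_filter, Finset.mem_Icc, not_le] at hn
          exact abs_mainInner_sub_le_big hE0 hE1 hE2 hε hN256 hKN hn.2 hn.1.2 (hm₁ n)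
            (hm₂ n hn.1.1)
      _ ≤ S N * (if 𝔖 = 0 then 32 * C / Real.log N + C
              else (32 * |𝔖| * C + 4 * C) / (|𝔖| * Real.log N)) := by
          rw [← Finset.sum_mul]
          refine mul_le_mul_of_nonneg_right ?_ ?_
          · exact Finset.sum_le_sum_of_subset_of_nonneg (Finset.filter_subset _ _)
              (fun n _ _ => hF n)
          · split_ifs <;> positivity
  -- term 3
  have h3' : |ρ| * (|S N - 𝔖 * N| + Ssmall) ≤ η / 4 * N + |ρ| * ((|𝔖| + 1) * Real.sqrt N) := by
    calc |ρ| * (|S N - 𝔖 * N| + Ssmall) ≤ |ρ| * (κ * N + (|𝔖| + 1) * Real.sqrt N) :=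
          mul_le_mul_of_nonneg_left (add_le_add h1 hSsmall_le) (abs_nonneg _)
      _ = |ρ| * κ * N + |ρ| * ((|𝔖| + 1) * Real.sqrt N) := by ring
      _ ≤ η / 4 * N + |ρ| * ((|𝔖| + 1) * Real.sqrt N) := by
          gcongr
  -- collect
  have hcollect : Triv * Ssmall + |ρ| * ((|𝔖| + 1) * Real.sqrt N) ≤ η / 4 * N := by
    refine le_trans ?_ h3
    have : Triv * Ssmall ≤ Triv * ((|𝔖| + 1) * Real.sqrt N) :=
      mul_le_mul_of_nonneg_left hSsmall_le hTriv0
    rw [hTriv] at this ⊢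
    nlinarith
  change ∑ n ∈ (Icc 1 N).filter (fun n => n ≤ T), F n * |I n| +
      ∑ n ∈ (Icc 1 N).filter (fun n => ¬ n ≤ T), F n * |I n - ρ| +
      |ρ| * (|S N - 𝔖 * N| + Ssmall) ≤ η * N
  nlinarith

end RungMain

open Literature.NumberTheory.Sieve

/-- **stub_rungMainPart — the main term of the rung.** For `t ≥ 1`, a positive `t`-system `Φ`, a
positive form `ψ` with `vecCons ψ Φ` non-degenerate, assuming elementary Hardy–Littlewood for `Φ`
(`∑_{n ≤ N} ∏ᵢ Λ(Φᵢ(n)) = 𝔖(Φ) N + o(N)`) and the three Euler estimates of `stub_slopedEuler` for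
the sieve weight `w̃`, the main term of the rung satisfies, for every `ε₁ ∈ (0, 1/8]`,
`∑_{n ≤ N} ∏ᵢ Λ(Φᵢ(n)) ∑_{d ≤ ψ(n)/(⌊N^{ε₁}⌋+1)} μ(d) w̃(d) log(ψ(n)/d) = 𝔖(vecCons ψ Φ) N + o(N)`.
This is `RungMain.main_abstract` with `F(n) = ∏ᵢ Λ(Φᵢ(n)) ≥ 0`, `m(n) = ψ(n)`,
`n ≤ m(n) ≤ (α + β) n`, and `w̃(1) = 1`. [folklore] -/
theorem stub_rungMainPart :
    ∀ t : ℕ, 1 ≤ t → ∀ (Φ : Fin t → Literature.NumberTheory.Sieve.AffLinForm 1) (ψ : Literature.NumberTheory.Sieve.AffLinForm 1), Literature.NumberTheory.Sieve.IsNondegenerateSystem (Matrix.vecCons ψ Φ) → (∀ i, 0 < (Φ i).coeff 0 ∧ 0 ≤ (Φ i).const) → (0 < ψ.coeff 0 ∧ 0 ≤ ψ.const) → ((fun N : ℕ => ∑ n ∈ Finset.Icc 1 N, ∏ i, Literature.NumberTheory.Sieve.intVonMangoldt ((Φ i).eval ![(n : ℤ)]) - Literature.NumberTheory.Sieve.singularProduct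 Φ * N) =o[Filter.atTop] fun N : ℕ => (N : ℝ)) → (∃ C : ℝ, ∀ x : ℕ, 2 ≤ x → |∑ d ∈ Finset.Icc 1 x, (ArithmeticFunction.moebius d : ℝ) * (∑ ρ ∈ Finset.range (d / Int.gcd (ψ.coeff 0) d), if (d : ℤ) ∣ ψ.eval ![(ρ : ℤ)] then (if ∀ i, Int.gcd ((Φ i).eval ![(ρ : ℤ)]) (d / Int.gcd (ψ.coeff 0) d) = 1 then ((((Finset.range (d / Int.gcd (ψ.coeff 0) d)).filter (fun ρ' : ℕ => ∀ i, Int.gcd ((Φ i).eval ![(ρ' : ℤ)]) (d / Int.gcd (ψ.coeff 0) d) = 1)).card : ℝ))⁻¹ else 0) else (0 : ℝ))| ≤ C / Real.log x ^ 2 ∧ |∑ d ∈ Finset.Icc 1 x, (ArithmeticFunction.moebius d : ℝ) * (∑ ρ ∈ Finset.range (d / Int.gcd (ψ.coeff 0) d), if (d : ℤ) ∣ ψ.eval ![(ρ : ℤ)] then (if ∀ i, Int.gcd ((Φ i).eval ![(ρ : ℤ)]) (d / Int.gcd (ψ.coeff 0) d) = 1 then ((((Finset.range (d / Int.gcd (ψ.coeff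 0) d)).filter (fun ρ' : ℕ => ∀ i, Int.gcd ((Φ i).eval ![(ρ' : ℤ)]) (d / Int.gcd (ψ.coeff 0) d) = 1)).card : ℝ))⁻¹ else 0) else (0 : ℝ)) * Real.log d| ≤ C ∧ |Literature.NumberTheory.Sieve.singularProduct Φ * (∑ d ∈ Finset.Icc 1 x, (ArithmeticFunction.moebius d : ℝ) * (∑ ρ ∈ Finset.range (d / Int.gcd (ψ.coeff 0) d), if (d : ℤ) ∣ ψ.eval ![(ρ : ℤ)] then (if ∀ i, Int.gcd ((Φ i).eval ![(ρ : ℤ)]) (d / Int.gcd (ψ.coeff 0) d) = 1 then ((((Finset.range (d / Int.gcd (ψ.coeff 0) d)).filter (fun ρ' : ℕ => ∀ i, Int.gcd ((Φ i).eval ![(ρ' : ℤ)]) (d / Int.gcd (ψ.coeff 0) d) = 1)).card : ℝ))⁻¹ else 0) else (0 : ℝ)) * Real.log d) + Literature.NumberTheory.Sieve.singularProduct (Matrix.vecCons ψ Φ)| ≤ C / Real.log x) → ∀ ε₁ : ℝ, 0 < ε₁ → ε₁ ≤ 1 / 8 → ∀ η : ℝ, 0 < η → ∃ N₀ : ℕ,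 ∀ N : ℕ, N₀ ≤ N → |∑ n ∈ Finset.Icc 1 N, (∏ i, Literature.NumberTheory.Sieve.intVonMangoldt ((Φ i).eval ![(n : ℤ)])) * ∑ d ∈ Finset.Icc 1 (Int.toNat (ψ.eval ![(n : ℤ)]) / (⌊(N : ℝ) ^ ε₁⌋₊ + 1)), (ArithmeticFunction.moebius d : ℝ) * (∑ ρ ∈ Finset.range (d / Int.gcd (ψ.coeff 0) d), if (d : ℤ) ∣ ψ.eval ![(ρ : ℤ)] then (if ∀ i, Int.gcd ((Φ i).eval ![(ρ : ℤ)]) (d / Int.gcd (ψ.coeff 0) d) = 1 then ((((Finset.range (d / Int.gcd (ψ.coeff 0) d)).filter (fun ρ' : ℕ => ∀ i, Int.gcd ((Φ i).eval ![(ρ' : ℤ)]) (d / Int.gcd (ψ.coeff 0) d) = 1)).card : ℝ))⁻¹ else 0) else (0 : ℝ)) * Real.log ((Int.toNat (ψ.eval ![(n : ℤ)]) : ℝ) / d) - Literature.NumberTheory.Sieve.singularProduct (Matrix.vecCons ψ Φ) * N| ≤ η * N := by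
  intro t _ Φ ψ _ _ hψ hS hEu ε₁ _ hε η hη
  obtain ⟨C, hC⟩ := hEu
  have hev : ∀ n : ℕ, ψ.eval ![(n : ℤ)] = ψ.coeff 0 * n + ψ.const := fun n => by
    simp [AffLinForm.eval]
  have hα := hψ.1
  have hβ := hψ.2
  have hm0 : ∀ n : ℕ, (Int.toNat (ψ.eval ![(n : ℤ)]) : ℤ) = ψ.coeff 0 * n + ψ.const := fun n => by
    rw [Int.toNat_of_nonneg (by rw [hev]; positivity), hev]
  have hm₁ : ∀ n : ℕ, n ≤ Int.toNat (ψ.eval ![(n : ℤ)]) := fun n => by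
    have h := hm0 n
    have : (n : ℤ) ≤ ψ.coeff 0 * n + ψ.const := by nlinarith
    omega
  set K : ℕ := Int.toNat (ψ.coeff 0 + ψ.const) with hK
  have hKz : (K : ℤ) = ψ.coeff 0 + ψ.const := Int.toNat_of_nonneg (by linarith)
  have hm₂ : ∀ n : ℕ, 1 ≤ n → Int.toNat (ψ.eval ![(n : ℤ)]) ≤ K * n := fun n hn => by
    have h1 : ψ.coeff 0 * n + ψ.const ≤ (ψ.coeff 0 + ψ.const) * n := by
      have : (1 : ℤ) ≤ n := by exact_mod_cast hn
      nlinarith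
    have h2 : (Int.toNat (ψ.eval ![(n : ℤ)]) : ℤ) ≤ (K : ℤ) * n := by rw [hm0, hKz]; exact h1
    exact_mod_cast h2
  have hF : ∀ n : ℕ, 0 ≤ ∏ i, intVonMangoldt ((Φ i).eval ![(n : ℤ)]) := fun n =>
    Finset.prod_nonneg fun i _ => ArithmeticFunction.vonMangoldt_nonneg
  -- the sieve weight `w̃` (verbatim from the statement) and `w̃(1) = 1`
  set W : ℕ → ℝ := fun d : ℕ => (∑ ρ ∈ Finset.range (d / Int.gcd (ψ.coeff 0) d),
    if (d : ℤ) ∣ ψ.eval ![(ρ : ℤ)] then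
      (if ∀ i, Int.gcd ((Φ i).eval ![(ρ : ℤ)]) (d / Int.gcd (ψ.coeff 0) d) = 1 then
        ((((Finset.range (d / Int.gcd (ψ.coeff 0) d)).filter (fun ρ' : ℕ =>
          ∀ i, Int.gcd ((Φ i).eval ![(ρ' : ℤ)]) (d / Int.gcd (ψ.coeff 0) d) = 1)).card : ℝ))⁻¹
      else 0)
    else (0 : ℝ)) with hW
  have hW1 : W 1 = 1 := by
    simp [hW]
  exact RungMain.main_abstract (F := fun n : ℕ => ∏ i, intVonMangoldt ((Φ i).eval ![(n : ℤ)]))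
    (m := fun n : ℕ => Int.toNat (ψ.eval ![(n : ℤ)]))
    (W := W) hF hm₁ hm₂ hW1 hS hC hε hη

end Summit.Parity.GeneralizedHardyLittlewood.Theorems.PairsToGHL.SlopedLadder
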